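import Literature.AlgebraicGeometry.HodgeTheory.RealSl2BlocksTimesQuaternionInvariance
import Literature.AlgebraicGeometry.HodgeTheory.RealSl2BlocksTimesGenericProducts
import Literature.AlgebraicGeometry.HodgeTheory.SimpleAbelianSurfacePowersHodgeClasses
import Literature.AlgebraicGeometry.HodgeTheory.NoTypeIVFactorOrthogonalProducts
import Literature.AlgebraicGeometry.Motives.AbelianVarietySimpleOfEndAlgebraDomain
import HarnessLib

/-!
# `B = D` and the Hodge conjecture on all `E^{M+1} × S^{N+1}` for a non-CM elliptic curve `E` and EVERY simple abelian surface `S` — the last case, `S` with quaternionic or quartic CM multiplication (`dim_ℚ End⁰(S) = 4`), PROVED (Hazama 1989 / Moonen–Zarhin 1999 Thm. (3.2) and Thm. 0.1 (4))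

Family `hodge`, layer `Literature/AlgebraicGeometry/HodgeTheory`. Research context: cell `pub-hodge-ring2`
(HONEST FRAMING: research route conditional on HC_CM; not a corollary; Q11.4-sentence-2 already refuted in
dim ≥ 3), Literature lane, programme R16 («`E × S(II(1))`»), final assembly. UNCONDITIONAL; theorems only, no
definition, no named fact; nothing here uses or asserts HC_CM; no step towards a summit statement. This file is the
CLONE of `RealSl2BlocksTimesGenericProducts` (programme R14: `E × S` for `End⁰(S) = ℚ`) with the generic factor
replaced by a SIMPLE abelian surface `S` with `dim_ℚ End⁰(S) = 4`, fed by the invariance theorem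
`AVSlots.exists_coeff_killed_at_real_places_of_prod_isSimple_endRankFour` (`RealSl2BlocksTimesQuaternionInvariance`;
the graph `Γ_φ` of Moonen–Zarhin's (3.1) excluded by anisotropy of the commutant of the division algebra `End⁰(S)`,
`Motives/HodgeThetaAnnihilatorSymplecticTimesAnisotropic`), and by the tree's `B(S^{N+1}) = D(S^{N+1})` for abelian
surfaces with quaternionic multiplication (`AbelianVariety.isDivisorGenerated_powSucc_of_surface_realSplitting`,
programme R7, Moonen–Zarhin (2.2) Type 2(1), from a real splitting `ℝ ⊗ End⁰(S) ≅ M₂(ℝ)`).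

PUBLISHED STATEMENT. Moonen–Zarhin, Math. Ann. 315 (1999), §3 Thm. (3.2)(1) (after Hazama, Duke Math. J. 58
(1989); Gordon's survey Thm. 7.6.2): «Let `X₁` and `X₂` be complex abelian varieties which both satisfy
condition (D). (1) Suppose `X₁` and `X₂` contain no factors of Type 4. Then `X₁ × X₂` again satisfies (D), and
either `Hom(X₁, X₂) ≠ 0` or `Hg(X₁ × X₂) = Hg(X₁) × Hg(X₂)`», and the main Theorem of the introduction
(cited as Thm. 0.1): «Let `X` be a complex abelian variety with `dim(X) ≤ 4`. […] (4) Suppose we are not in one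
of the cases (a), (b), (c) or (d). Then `Hg(X) = Sp_D(V,φ)` and `B•(Xⁿ) = D•(Xⁿ)` for all `n`»
[corpus: paper:arxiv-math_9901113 p. 1, p. 6]. This file PROVES the row `X = E × S` of (4) with `E` an elliptic
curve WITHOUT complex multiplication and `S` a simple abelian surface of Type II(1) (`End⁰(S)` an indefinite
quaternion division algebra, here: `S` simple, `dim S = 2`, a real splitting `Φ₁ : ℝ ⊗ End⁰(S) ≃ M₂(ℝ)`): neither
factor has a factor of Type 4, `Hom(E, S) = 0`, both satisfy (D) (`B(Eⁿ) = D(Eⁿ)`, `B(Sⁿ) = D(Sⁿ)` — in the tree),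
so `B((E × S)ⁿ) = D((E × S)ⁿ)` for all `n`; the same argument covers `S` simple of Type IV(2,1) (`End⁰(S)` a
quartic CM field: again a division algebra of dimension `4 = dim H¹(S)`, and `B(Sⁿ) = D(Sⁿ)` in the tree). With the
tree's R14 (`S` of Type I(1)) and `RealSl2BlocksProducts` (`S` of Type I(2)) this gives §4: **`E × S` is stably
nondegenerate for EVERY simple abelian surface `S` and every elliptic curve `E` with `End⁰(E) = ℚ`** (the four
types of Moonen–Zarhin (2.2), `dim_ℚ End⁰(S) ∈ {1, 2, 4}`).

RESULTS.
* §1 `exists_quaternionLetters_hodgeClasses_mem_span_map_divisor_cup_monomial` / `…_prod_mem_span` — the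
  evaluated invariance theorem: Hodge classes of `X` (slots over `E × S`) are combinations of
  `f₁^* d ⌣ f₂^*(monomial in the letters of S)`, `d` a complexified divisor class (clone of R14 §1).
* §2 `hodgeClassesProductSpan_of_avSlots_curve_quaternion` — `HodgeClassesProductSpan B Z` for `B` with slots
  over `E`, `Z` with slots over `S`; `isDivisorGenerated_prod_of_avSlots_curve_quaternion` — `B(Z) = D(Z) ⟹
  B(B × Z) = D(B × Z)`; `isStablyNondegenerate_curve_prod_of_isSimple_endRankFour` — `E × S` is stably nondegenerate
  as soon as `S` is (no real splitting needed: any simple surface `S` with `dim_ℚ End⁰(S) = 4` all of whose powers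
  have `B = D`).
* §3 `isStablyNondegenerate_curve_prod_of_isSimple_surface_endRankFour` — `E × S` stably nondegenerate for
  `End⁰(E) = ℚ`, `S` simple with `dim_ℚ End⁰(S) = 4` (`B(Sⁿ) = D(Sⁿ)`: the tree's
  `AbelianVariety.isStablyNondegenerate_of_isSimple_surface`); the Type II(1) row from a real splitting
  `Φ₁ : ℝ ⊗ End⁰(S) ≃ M₂(ℝ)`: **`isStablyNondegenerate_curve_prod_of_surface_realSplitting`**.
* §4 **`isStablyNondegenerate_curve_prod_of_isSimple_surface`** — `E × S` stably nondegenerate for `End⁰(E) = ℚ`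
  and EVERY simple abelian surface `S`; all mixed powers `E^{M+1} × S^{N+1}`, `B = D`, the Hodge conjecture for
  them and for everything isogenous to a power of `E × S` — UNCONDITIONAL, no binder.

## References
* [MoonenZarhin1999LowDim] B. Moonen, Yu. Zarhin, Math. Ann. 315 (1999) 711–733, Thm. 0.1 (4), §2 (2.2),
  condition (D), §3 (3.1), Thm. (3.2)(1) [corpus: paper:arxiv-math_9901113 p. 1, 4–6]. [cite: MoonenZarhin1999LowDim, §3 Thm. (3.2)(1)]
* [Hazama1989] F. Hazama, Duke Math. J. 58 (1989) 31–37 (= Gordon 7.6.2). [cite: Hazama1989, Thm. (= Gordon 7.6.2)]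
* [Hazama1983] F. Hazama, Tôhoku Math. J. 35 (1983), Thm. (1.1), §3. [cite: Hazama1983, §3 (pp. 305–306)]
* [BanaszakGajdaKrason2006] G. Banaszak, W. Gajda, P. Krasoń, Doc. Math. Extra Vol. Coates (2006), p. 36, (7.22),
  Thm. 7.34. [cite: BanaszakGajdaKrason2006, p. 36, (7.22) and Thm. 7.34]
* [Gordon1999HodgeAVSurvey] B. B. Gordon, App. B of Lewis (1999), Thm. 7.5, Def. 7.6, Thm. 7.6.2. [cite: Gordon1999HodgeAVSurvey, Thm. 7.5 and Thm. 7.6.2]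
* [vanGeemen1994HodgeAV] B. van Geemen, LNM 1594 (1994), §2.4–2.5, Lemma 3.7, Thm. 4.2. [cite: vanGeemen1994HodgeAV, Thm. 4.2 and Lemma 3.7]
* [MumfordAV1970] D. Mumford, *Abelian Varieties* (1970), §19 Cor. 2 of Thm. 1 (p. 174). [cite: MumfordAV1970, §19 Cor. 2 of Thm. 1 (p. 174)]
* [HatcherAT2002] A. Hatcher, *Algebraic Topology* (2002), §3.2 Thm. 3.16. [cite: HatcherAT2002, §3.2 Thm. 3.16]
-/

noncomputable section

open scoped TensorProduct
open CategoryTheory Module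

namespace Literature.AlgebraicGeometry.HodgeTheory

open Literature.AlgebraicTopology.SingularHomology
open Literature.AlgebraicGeometry.Motives (IsSmoothProjective AbelianVariety bettiCohomology
  ofRatClassBaseChange ofRatClassBaseChange_tmul HodgeTensorFacts hodgeTensorFacts_holds)
open Literature.Barriers.HodgeConjecture
open Literature.AlgebraicGeometry.Motives.HodgeStructure
open Literature.AlgebraicGeometry.ComplexMultiplication
open Literature.RepresentationTheory.GeneralLinear
open Literature.NumberTheory.DiophantineGeometry

/-! ### §1 The evaluated invariance theorem: Hodge classes over `E × S` are (divisor classes) ⌣ (monomials in the letters of `S`) -/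

section Core

variable {A B C Z X : AbelianVariety ℂ} {n : ℕ}

/-- **CORE ASSEMBLY (Hazama 1989 / Moonen–Zarhin 1999 Thm. (3.2)(1) and (3.1) for a non-CM elliptic curve times a
simple abelian surface with `dim_ℚ End⁰ = 4`, evaluated).** Let `A` be an elliptic curve with `End⁰(A) = ℚ`
(`dim A = 1`, `dim_ℚ End⁰(A) = 1`: real `𝔰𝔩₂`-block data of rank two, `hasRealSl2Blocks_of_finrank_endAlgebra_eq_one`),
`C` SIMPLE with `dim C = 2` and `dim_ℚ End⁰(C) = 4` (quaternionic multiplication), and let `X` have slots `g` over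
`A × C` whose `A`-components factor as `g_j ≫ pr_A = f₁ ≫ gB_j` through `f₁ : X → B` and whose `C`-components
factor as `g_j ≫ pr_C = f₂ ≫ gC_j` through `f₂ : X → Z`. Then there is a Hodge-adapted pair basis
`(c_i^0 ∈ H^{1,0}, c_i^1 ∈ H^{0,1})_{i<h}` of `H¹(C) ⊗ ℂ` such that every rational class of type `(p,p)` on `X`
is a `ℂ`-combination of classes `f₁^* d ⌣ f₂^*(y_{w(1)} ⌣ ⋯ ⌣ y_{w(r)})` with `d ∈ D^{p'}(B) ⊗ ℂ`
(`divisorClassesSpan`), `2p' + r = 2p`, and `y_{((j,i),κ)} = gC_j^* ρ(c_i^κ) ∈ H¹(Z(ℂ); ℂ)`.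
[cite: MoonenZarhin1999LowDim, §3 (3.1) and Thm. (3.2)(1)] [cite: Hazama1989, Thm. (= Gordon 7.6.2)]
[cite: Hazama1983, Thm. (1.1) and §3 (pp. 305–306)] -/
theorem exists_quaternionLetters_hodgeClasses_mem_span_map_divisor_cup_monomial
    (hA1 : Module.finrank ℚ A.endAlgebra = 1) (hA : A.dim = 1)
    (hS : C.IsSimple) (hCend : Module.finrank ℚ C.endAlgebra = 4) (hCdim : C.dim = 2) {g : Fin n → (X ⟶ A.prod C)}
    (hg : AVSlots (A.prod C) X g) (f₁ : X ⟶ B) (f₂ : X ⟶ Z) (gB : Fin n → (B ⟶ A)) (gC : Fin n → (Z ⟶ C))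
    (hf₁ : ∀ j, g j ≫ Motives.AbelianVariety.fst A C = f₁ ≫ gB j)
    (hf₂ : ∀ j, g j ≫ Motives.AbelianVariety.snd A C = f₂ ≫ gC j) :
    ∃ (h : ℕ) (cC : Module.Basis (Fin h × Fin 2) ℂ (ℂ ⊗[ℚ] bettiCohomology C.X 1)),
      (∀ i, (cC (i, 0)) ∈ (BettiUniverse.hodge exists_isReal_hodgeModel_holds
        (Motives.AbelianVariety.isSmoothProjective_holds (A := C)) 1).piece 1 0) ∧
      (∀ i, (cC (i, 1)) ∈ (BettiUniverse.hodge exists_isReal_hodgeModel_holds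
        (Motives.AbelianVariety.isSmoothProjective_holds (A := C)) 1).piece 0 1) ∧
      ∀ (p : ℕ) (c : complexBetti X.X (2 * p)), IsRationalClass c → IsOfHodgeType X.dim X.X (2 * p) p p c →
        c ∈ Submodule.span ℂ {z : complexBetti X.X (2 * p) | ∃ (p' r : ℕ) (hpr : 2 * p' + r = 2 * p)
          (dB : complexBetti B.X (2 * p')) (w : Fin r → (Fin n × Fin h) × Fin 2),
          dB ∈ divisorClassesSpan B.X B.dim p' ∧
          z = cupProduct hpr (complexBetti.map f₁.hom.hom.hom (2 * p') dB)
            (complexBetti.map f₂.hom.hom.hom r (cupPowOne ℂ (Motives.ComplexPoints Z.X) r (fun t =>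
              complexBetti.map (gC (w t).1.1).hom.hom.hom 1
                (ofRatClassBaseChange (Motives.ComplexPoints C.X) 1 (cC ((w t).1.2, (w t).2))))))} := by
  classical
  -- unpack the real `𝔰𝔩₂`-block data of the non-CM elliptic curve `A` (`hasRealSl2Blocks_of_finrank_endAlgebra_eq_one`)
  obtain ⟨hc, ι, _, _, τ, hreal, hint, h2, b, hb0, hb1, hθ⟩ := hasRealSl2Blocks_of_finrank_endAlgebra_eq_one A hA1 hA
  have hHD : exists_isReal_hodgeModel := exists_isReal_hodgeModel_holds
  have hI : hodgePQ_independent_of_hodgeModel := hodgePQ_independent_of_hodgeModel_holds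
  haveI : HodgeTensorFacts.{0, 0} := hodgeTensorFacts_holds.{0, 0}
  haveI : Module.Finite ℚ (bettiCohomology A.X 1) := finite_bettiCohomology_one A
  have hXA : IsSmoothProjective A.dim A.X := Motives.AbelianVariety.isSmoothProjective_holds
  obtain ⟨ψ⟩ : (BettiUniverse.hodge hHD (Motives.AbelianVariety.isSmoothProjective_holds (A := A)) 1).IsPolarizable :=
    smoothProjective_hodgeStructure_isPolarizable_holds hXA (BettiUniverse.realHodgeModel hHD hXA)
      (BettiUniverse.realHodgeModel_isHodgeSymmetric hHD hXA) 1
  set Φ := endAlgebraAlgEquivEndAlgOfComm hc hHD hI with hΦ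
  have heq : ∀ i, (BettiUniverse.hodge hHD (Motives.AbelianVariety.isSmoothProjective_holds (A := A)) 1).eigenBlock
      ((τ i).comp Φ.symm.toRingEquiv.toRingHom) =
      ⨅ e : A.endAlgebra, Module.End.eigenspace ((MulOpposite.unop (bettiRep A e)).baseChange ℂ) (τ i e) :=
    fun i => eigenBlock_comp_endAlgebraAlgEquivEndAlgOfComm_symm hc hHD hI (τ i)
  have hreal' : ∀ i, (starRingEnd ℂ).comp ((τ i).comp Φ.symm.toRingEquiv.toRingHom) =
      (τ i).comp Φ.symm.toRingEquiv.toRingHom :=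
    fun i => comp_endAlgebraAlgEquivEndAlgOfComm_symm_isReal hc hHD hI (hreal i)
  have hfun : (fun i => (BettiUniverse.hodge hHD (Motives.AbelianVariety.isSmoothProjective_holds (A := A)) 1).eigenBlock
      ((τ i).comp Φ.symm.toRingEquiv.toRingHom)) = fun i => (⨅ e : A.endAlgebra,
        Module.End.eigenspace ((MulOpposite.unop (bettiRep A e)).baseChange ℂ) (τ i e) : Submodule ℂ _) :=
    funext heq
  have hint' : DirectSum.IsInternal fun i =>
      (BettiUniverse.hodge hHD (Motives.AbelianVariety.isSmoothProjective_holds (A := A)) 1).eigenBlock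
        ((τ i).comp Φ.symm.toRingEquiv.toRingHom) := by
    rw [hfun]; exact hint
  have h2' : ∀ i, Module.finrank ℂ
      ((BettiUniverse.hodge hHD (Motives.AbelianVariety.isSmoothProjective_holds (A := A)) 1).eigenBlock
        ((τ i).comp Φ.symm.toRingEquiv.toRingHom)) = 2 := fun i => by rw [heq]; exact h2 i
  have hself := isAdjointPair_self_of_real_characters
    (BettiUniverse.hodge hHD (Motives.AbelianVariety.isSmoothProjective_holds (A := A)) 1) (by norm_num)
    (BettiUniverse.hodge_isEffective hHD hXA 1) ψ _ hreal' hint'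
  let b' : ∀ i, Module.Basis (Fin 2) ℂ
      ((BettiUniverse.hodge hHD (Motives.AbelianVariety.isSmoothProjective_holds (A := A)) 1).eigenBlock
        ((τ i).comp Φ.symm.toRingEquiv.toRingHom)) :=
    fun i => (b i).map (LinearEquiv.ofEq _ _ (heq i).symm)
  have hb' : ∀ i r, (b' i r : ℂ ⊗[ℚ] bettiCohomology A.X 1) = (b i r : ℂ ⊗[ℚ] bettiCohomology A.X 1) :=
    fun i r => rfl
  have hb0' : ∀ i, (b' i 0 : ℂ ⊗[ℚ] bettiCohomology A.X 1) ∈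
      (BettiUniverse.hodge hHD (Motives.AbelianVariety.isSmoothProjective_holds (A := A)) 1).piece 1 0 :=
    fun i => by rw [hb']; exact hb0 i
  have hb1' : ∀ i, (b' i 1 : ℂ ⊗[ℚ] bettiCohomology A.X 1) ∈
      (BettiUniverse.hodge hHD (Motives.AbelianVariety.isSmoothProjective_holds (A := A)) 1).piece 0 1 :=
    fun i => by rw [hb']; exact hb1 i
  have hθ' : ∀ i, cupH1 A (b' i 0 : ℂ ⊗[ℚ] bettiCohomology A.X 1) (b' i 1) ∈
      Submodule.span ℂ {c : complexBetti A.X 2 | IsRationalClass c ∧ IsOfHodgeType A.dim A.X 2 1 1 c} :=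
    fun i => by rw [hb', hb']; exact hθ i
  -- rank two and `End_Hdg(H¹ A) = ℚ`
  have hV₁ : Module.finrank ℚ (bettiCohomology A.X 1) = 2 := by rw [finrank_bettiCohomology_one A, hA]
  have hAend := exists_eq_smul_one_of_finrank_endAlgebra_eq_one (A := A) hHD hI hA1 (by rw [hA]; exact one_pos)
  -- the invariance theorem for slots over `A × C`
  obtain ⟨h, cC, hcC0, hcC1, hmain⟩ := hg.exists_coeff_killed_at_real_places_of_prod_isSimple_endRankFour hHD hI ψ
    hself _ hreal' hint' h2' b' hb0' hb1' hV₁ hAend hS hCend hCdim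
  refine ⟨h, cC, hcC0, hcC1, fun p c hcQ hcpp => ?_⟩
  rcases Nat.eq_zero_or_pos p with rfl | hp
  · -- degree `0`: `c = s · 1_X = f₁^*(s · 1_B) ⌣ f₂^*(1_Z)` with `s · 1_B ∈ D⁰(B) ⊗ ℂ`
    have h1 : c ∈ Submodule.span ℂ {singularCohomology.one ℂ (Motives.ComplexPoints X.X)} :=
      AbelianVariety.mem_divisorClassesSpan_zero X c
    obtain ⟨s, hs⟩ := Submodule.mem_span_singleton.1 h1
    refine Submodule.subset_span ⟨0, 0, rfl, s • singularCohomology.one ℂ (Motives.ComplexPoints B.X),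
      Fin.elim0, Submodule.smul_mem _ _ (AbelianVariety.mem_divisorClassesSpan_zero B _), ?_⟩
    rw [← hs, map_smul, LinearMap.map_smul₂, cupPowOne_zero]
    erw [singularCohomology.map_one, singularCohomology.map_one, cupProduct_one]
  · obtain ⟨a, hca, hkill⟩ := hmain hp hcQ hcpp
    -- the letters of `X` over `A × C` are `f₁^*`(letters of `B` over `A`) and `f₂^*`(letters of `Z` over `C`)
    have hletters : (fun jr : (Fin n × (ι ⊕ Fin h)) × Fin 2 => complexBetti.map (g jr.1.1).hom.hom.hom 1
        (Sum.elim
          (fun τ' => complexBetti.map (Motives.AbelianVariety.fst A C).hom.hom.hom 1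
            (ofRatClassBaseChange (Motives.ComplexPoints A.X) 1 (b' τ' jr.2 : ℂ ⊗[ℚ] bettiCohomology A.X 1)))
          (fun i => complexBetti.map (Motives.AbelianVariety.snd A C).hom.hom.hom 1
            (ofRatClassBaseChange (Motives.ComplexPoints C.X) 1 (cC (i, jr.2))))
          jr.1.2)) =
        fun jr : (Fin n × (ι ⊕ Fin h)) × Fin 2 => Sum.elim
          (fun τ' => complexBetti.map f₁.hom.hom.hom 1 (rmLetters gB b' ((jr.1.1, τ'), jr.2)))
          (fun i => complexBetti.map f₂.hom.hom.hom 1 ((fun y : (Fin n × Fin h) × Fin 2 =>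
            complexBetti.map (gC y.1.1).hom.hom.hom 1
              (ofRatClassBaseChange (Motives.ComplexPoints C.X) 1 (cC (y.1.2, y.2)))) ((jr.1.1, i), jr.2)))
          jr.1.2 := by
      funext jr
      obtain ⟨⟨j, t⟩, κ⟩ := jr
      rcases t with τ' | i
      · simp only [Sum.elim_inl, rmLetters_apply]
        rw [complexBetti_map_map_hom, complexBetti_map_map_hom, hf₁]
      · simp only [Sum.elim_inr]
        rw [complexBetti_map_map_hom, complexBetti_map_map_hom, hf₂]
    have hmem := wordEval_mem_span_divisor_cup_monomial f₁ f₂ gB b' hθ'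
      (fun y : (Fin n × Fin h) × Fin 2 => complexBetti.map (gC y.1.1).hom.hom.hom 1
        (ofRatClassBaseChange (Motives.ComplexPoints C.X) 1 (cC (y.1.2, y.2)))) (a := a)
      (fun U τ' => hkill U τ' _ (by simp)) (fun U τ' => hkill U τ' _ (by simp))
    rw [← hletters, hca] at hmem
    exact hmem

/-- **The Hodge classes of `X` (slots over `A × C`, `A` a non-CM elliptic curve, `C` a simple surface with
`dim_ℚ End⁰(C) = 4`) are `ℂ`-combinations of `d ⌣ (x_{w(1)} ⌣ ⋯ ⌣ x_{w(r)})` with `d ∈ D^{p'}(X) ⊗ ℂ` a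
complexified divisor class and the `x` the letters `g_j^* pr_C^* ρ(c_i^κ)` of `C`** — the invariants of
`Hg(A) × Hg(C)` in `H^{2p}(X)` lie in (divisor classes) ⊗ (everything on the `C`-side).
[cite: MoonenZarhin1999LowDim, §3 (3.1) and Thm. (3.2)(1)] [cite: Hazama1989, Thm. (= Gordon 7.6.2)]
[cite: Hazama1983, Thm. (1.1) and §3 (pp. 305–306)] -/
theorem exists_quaternionLetters_hodgeClasses_mem_span_divisor_cup_monomial
    (hA1 : Module.finrank ℚ A.endAlgebra = 1) (hA : A.dim = 1)
    (hS : C.IsSimple) (hCend : Module.finrank ℚ C.endAlgebra = 4) (hCdim : C.dim = 2) {g : Fin n → (X ⟶ A.prod C)}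
    (hg : AVSlots (A.prod C) X g) :
    ∃ (h : ℕ) (cC : Module.Basis (Fin h × Fin 2) ℂ (ℂ ⊗[ℚ] bettiCohomology C.X 1)),
      (∀ i, (cC (i, 0)) ∈ (BettiUniverse.hodge exists_isReal_hodgeModel_holds
        (Motives.AbelianVariety.isSmoothProjective_holds (A := C)) 1).piece 1 0) ∧
      (∀ i, (cC (i, 1)) ∈ (BettiUniverse.hodge exists_isReal_hodgeModel_holds
        (Motives.AbelianVariety.isSmoothProjective_holds (A := C)) 1).piece 0 1) ∧
      ∀ (p : ℕ) (c : complexBetti X.X (2 * p)), IsRationalClass c → IsOfHodgeType X.dim X.X (2 * p) p p c →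
        c ∈ Submodule.span ℂ {z : complexBetti X.X (2 * p) | ∃ (p' r : ℕ) (hpr : 2 * p' + r = 2 * p)
          (d : complexBetti X.X (2 * p')) (w : Fin r → (Fin n × Fin h) × Fin 2),
          d ∈ divisorClassesSpan X.X X.dim p' ∧
          z = cupProduct hpr d (cupPowOne ℂ (Motives.ComplexPoints X.X) r (fun t =>
              complexBetti.map (g (w t).1.1 ≫ Motives.AbelianVariety.snd A C).hom.hom.hom 1
                (ofRatClassBaseChange (Motives.ComplexPoints C.X) 1 (cC ((w t).1.2, (w t).2)))))} := by
  obtain ⟨h, cC, hcC0, hcC1, hcore⟩ :=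
    exists_quaternionLetters_hodgeClasses_mem_span_map_divisor_cup_monomial hA1 hA hS hCend hCdim hg (𝟙 X) (𝟙 X)
      (fun j => g j ≫ Motives.AbelianVariety.fst A C) (fun j => g j ≫ Motives.AbelianVariety.snd A C)
      (fun j => (Category.id_comp _).symm) (fun j => (Category.id_comp _).symm)
  refine ⟨h, cC, hcC0, hcC1, fun p c hcQ hc => ?_⟩
  have hid : ∀ (k : ℕ) (v : complexBetti X.X k), complexBetti.map (𝟙 X : X ⟶ X).hom.hom.hom k v = v :=
    fun k v => by
      change complexBetti.map (𝟙 X.X) k v = v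
      rw [complexBetti.map_id]
      rfl
  refine Submodule.span_mono ?_ (hcore p c hcQ hc)
  rintro z ⟨p', r, hpr, d, w, hd, rfl⟩
  refine ⟨p', r, hpr, d, w, hd, ?_⟩
  rw [hid, Motives.complexBetti_map_cupPowOne]
  simp only [hid]

/-- **The Hodge classes of `B × Z` (`B` with slots over a non-CM elliptic curve `A`, `Z` with as many slots over a
simple surface `C` with `dim_ℚ End⁰(C) = 4`) are `ℂ`-combinations of
`pr_B^* d ⌣ pr_Z^*(y_{w(1)} ⌣ ⋯ ⌣ y_{w(r)})`, `d ∈ D^{p'}(B) ⊗ ℂ`, `y` the letters `gC_j^* ρ(c_i^κ)` of `Z`** —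
«`Hg(X₁ × X₂) = Hg(X₁) × Hg(X₂)`» read on `H^{2p}(B × Z)`.
[cite: MoonenZarhin1999LowDim, §3 (3.1) and Thm. (3.2)(1)] [cite: Hazama1989, Thm. (= Gordon 7.6.2)]
[cite: Hazama1983, Thm. (1.1) and §3 (pp. 305–306)] -/
theorem exists_quaternionLetters_hodgeClasses_prod_mem_span (hA1 : Module.finrank ℚ A.endAlgebra = 1) (hA : A.dim = 1)
    (hS : C.IsSimple) (hCend : Module.finrank ℚ C.endAlgebra = 4) (hCdim : C.dim = 2)
    {gB : Fin n → (B ⟶ A)} {gC : Fin n → (Z ⟶ C)} (hgB : AVSlots A B gB) (hgC : AVSlots C Z gC) :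
    ∃ (h : ℕ) (cC : Module.Basis (Fin h × Fin 2) ℂ (ℂ ⊗[ℚ] bettiCohomology C.X 1)),
      (∀ i, (cC (i, 0)) ∈ (BettiUniverse.hodge exists_isReal_hodgeModel_holds
        (Motives.AbelianVariety.isSmoothProjective_holds (A := C)) 1).piece 1 0) ∧
      (∀ i, (cC (i, 1)) ∈ (BettiUniverse.hodge exists_isReal_hodgeModel_holds
        (Motives.AbelianVariety.isSmoothProjective_holds (A := C)) 1).piece 0 1) ∧
      ∀ (p : ℕ) (c : complexBetti (B.prod Z).X (2 * p)), IsRationalClass c →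
        IsOfHodgeType (B.prod Z).dim (B.prod Z).X (2 * p) p p c →
        c ∈ Submodule.span ℂ {z : complexBetti (B.prod Z).X (2 * p) | ∃ (p' r : ℕ) (hpr : 2 * p' + r = 2 * p)
          (dB : complexBetti B.X (2 * p')) (w : Fin r → (Fin n × Fin h) × Fin 2),
          dB ∈ divisorClassesSpan B.X B.dim p' ∧
          z = cupProduct hpr (complexBetti.map (Motives.AbelianVariety.fst B Z).hom.hom.hom (2 * p') dB)
            (complexBetti.map (Motives.AbelianVariety.snd B Z).hom.hom.hom r
              (cupPowOne ℂ (Motives.ComplexPoints Z.X) r (fun t =>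
                complexBetti.map (gC (w t).1.1).hom.hom.hom 1
                  (ofRatClassBaseChange (Motives.ComplexPoints C.X) 1 (cC ((w t).1.2, (w t).2))))))} :=
  exists_quaternionLetters_hodgeClasses_mem_span_map_divisor_cup_monomial hA1 hA hS hCend hCdim (hgB.prodLift hgC)
    (Motives.AbelianVariety.fst B Z) (Motives.AbelianVariety.snd B Z) gB gC
    (fun _ => Motives.AbelianVariety.prodLift_fst _ _) (fun _ => Motives.AbelianVariety.prodLift_snd _ _)

end Core

/-! ### §2 The product span, `B = D` on `B × Z`, and stable nondegeneracy of `A × C` -/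

section ProductSpan

variable {A B C Z : AbelianVariety ℂ} {n : ℕ} {gB : Fin n → (B ⟶ A)} {gC : Fin n → (Z ⟶ C)}

/-- **`HodgeClassesProductSpan B Z` — Moonen–Zarhin (3.1) for (non-CM elliptic curve) × (simple surface with
`dim_ℚ End⁰ = 4`), PROVED.** Let `A` be an elliptic curve with `End⁰(A) = ℚ`, `C` simple with `dim C = 2` and
`dim_ℚ End⁰(C) = 4`, `B` have `n` slots over `A` and `Z` have `n` slots over `C`. Then every rational class of
Hodge type `(p,p)` on `B × Z` is a `ℂ`-combination of exterior products `pr_B^* a ⌣ pr_Z^* b` of RATIONAL HODGE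
classes `a` of `B` and `b` of `Z`. [cite: MoonenZarhin1999LowDim, §3 (3.1) and Thm. (3.2)(1)]
[cite: Hazama1989, Thm. (= Gordon 7.6.2)] [cite: Hazama1983, Thm. (1.1) and §3 (pp. 305–306)] -/
theorem hodgeClassesProductSpan_of_avSlots_curve_quaternion (hA1 : Module.finrank ℚ A.endAlgebra = 1) (hA : A.dim = 1)
    (hS : C.IsSimple) (hCend : Module.finrank ℚ C.endAlgebra = 4) (hCdim : C.dim = 2)
    (hgB : AVSlots A B gB) (hgC : AVSlots C Z gC) : HodgeClassesProductSpan B Z := by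
  classical
  intro p c hcQ hc
  have hB : IsSmoothProjective B.dim B.X := Motives.AbelianVariety.isSmoothProjective_holds
  have hZ : IsSmoothProjective Z.dim Z.X := Motives.AbelianVariety.isSmoothProjective_holds
  have hXC : IsSmoothProjective C.dim C.X := Motives.AbelianVariety.isSmoothProjective_holds
  have hHD : exists_isReal_hodgeModel := exists_isReal_hodgeModel_holds
  have hI : hodgePQ_independent_of_hodgeModel := hodgePQ_independent_of_hodgeModel_holds
  obtain ⟨h, cC, hcC0, hcC1, hspan⟩ := exists_quaternionLetters_hodgeClasses_prod_mem_span hA1 hA hS hCend hCdim hgB hgC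
  have hc' : IsOfHodgeType (B.prod Z).dim (B.prod Z).X (2 * p) p p c := by
    rw [Motives.AbelianVariety.dim_prod]; exact hc
  have hmem := hspan p c hcQ hc'
  -- the letters of `Z` have types `(1,0)` / `(0,1)`
  set y : (Fin n × Fin h) × Fin 2 → complexBetti Z.X 1 := fun jr =>
    complexBetti.map (gC jr.1.1).hom.hom.hom 1 (ofRatClassBaseChange (Motives.ComplexPoints C.X) 1 (cC (jr.1.2, jr.2)))
    with hy
  have hy0 : ∀ jr : (Fin n × Fin h) × Fin 2, jr.2 = 0 → IsOfHodgeType Z.dim Z.X 1 1 0 (y jr) := by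
    rintro ⟨⟨j, i⟩, κ⟩ hκ
    change κ = 0 at hκ
    subst hκ
    exact ((BettiUniverse.mem_hodge_piece_iff hHD hI hXC (k := 1) (p := 1) (q := 0) rfl (cC (i, 0))).1
      (hcC0 i)).map_of_isSmoothProjective hZ hXC _
  have hy1 : ∀ jr : (Fin n × Fin h) × Fin 2, jr.2 = 1 → IsOfHodgeType Z.dim Z.X 1 0 1 (y jr) := by
    rintro ⟨⟨j, i⟩, κ⟩ hκ
    change κ = 1 at hκ
    subst hκ
    exact ((BettiUniverse.mem_hodge_piece_iff hHD hI hXC (k := 1) (p := 0) (q := 1) rfl (cC (i, 1))).1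
      (hcC1 i)).map_of_isSmoothProjective hZ hXC _
  -- monomials in the letters of `Z` have a pure type
  have hmono : ∀ (r : ℕ) (w : Fin r → (Fin n × Fin h) × Fin 2), ∃ r₀ r₁, r₀ + r₁ = r ∧
      IsOfHodgeType Z.dim Z.X r r₀ r₁ (cupPowOne ℂ (Motives.ComplexPoints Z.X) r (fun t => y (w t))) := by
    intro r w
    rcases Nat.eq_zero_or_pos r with rfl | hr
    · exact ⟨0, 0, rfl, isOfHodgeType_zero_zero_of_degree_zero hZ _⟩
    · refine ⟨∑ t, (if (w t).2 = 0 then 1 else 0), ∑ t, (if (w t).2 = 0 then 0 else 1), ?_,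
        isOfHodgeType_cupPowOne hZ hr (fun t => y (w t)) _ _ fun t => ?_⟩
      · rw [← Finset.sum_add_distrib]
        have h2 : ∀ t : Fin r, ((if (w t).2 = 0 then 1 else 0) + (if (w t).2 = 0 then 0 else 1) : ℕ) = 1 :=
          fun t => by split_ifs <;> rfl
        simp only [h2, Finset.sum_const, Finset.card_univ, Fintype.card_fin, smul_eq_mul, mul_one]
      · by_cases h0 : (w t).2 = 0
        · rw [if_pos h0, if_pos h0]; exact hy0 _ h0
        · have h1 : (w t).2 = 1 := by
            have h01 : ∀ x : Fin 2, x ≠ 0 → x = 1 := by decide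
            exact h01 _ h0
          rw [if_neg h0, if_neg h0]; exact hy1 _ h1
  -- feed the criterion
  refine mem_span_hodgeProductClasses_of_mem_span_typed B Z hcQ hc (Submodule.span_mono ?_ hmem)
  rintro z ⟨p', r, hpr, dB, w, hdB, rfl⟩
  obtain ⟨r₀, r₁, hr, htyp⟩ := hmono r w
  refine ⟨2 * p', r, hpr, dB, _, Submodule.span_mono ?_ hdB, ⟨r₀, r₁, hr, htyp⟩, rfl⟩
  intro d hd
  exact ⟨isRationalClass_of_mem_divisorMonomials hd, p', rfl, isOfHodgeType_of_mem_divisorMonomials hB hd⟩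

/-- **Moonen–Zarhin Thm. (3.2)(1) as condition (D) on `B × Z`, PROVED for this class**: `B` with `n` slots over
a non-CM elliptic curve `A`, `Z` with `n` slots over a simple surface `C` with `dim_ℚ End⁰(C) = 4`,
`B(Z) = D(Z)` ⟹ `B(B × Z) = D(B × Z)` (the product span, `B(B) = D(B)` by
`HasRealSl2Blocks.isDivisorGenerated_of_avSlots`, and `isDivisorGenerated_prod_of_productSpan`).
[cite: MoonenZarhin1999LowDim, §3 Thm. (3.2)(1)] [cite: Hazama1989, Thm. (= Gordon 7.6.2)] -/
theorem isDivisorGenerated_prod_of_avSlots_curve_quaternion (hA1 : Module.finrank ℚ A.endAlgebra = 1) (hA : A.dim = 1)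
    (hS : C.IsSimple) (hCend : Module.finrank ℚ C.endAlgebra = 4) (hCdim : C.dim = 2)
    (hgB : AVSlots A B gB) (hgC : AVSlots C Z gC) (hZD : IsDivisorGenerated Z) : IsDivisorGenerated (B.prod Z) :=
  isDivisorGenerated_prod_of_productSpan B Z (hodgeClassesProductSpan_of_avSlots_curve_quaternion hA1 hA hS hCend hCdim hgB hgC)
    ((hasRealSl2Blocks_of_finrank_endAlgebra_eq_one A hA1 hA).isDivisorGenerated_of_avSlots hgB) hZD

/-- **`E × S` is stably nondegenerate as soon as `S` is** — for `E` an elliptic curve with `End⁰(E) = ℚ` and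
`S` ANY simple abelian surface with `dim_ℚ End⁰(S) = 4` all of whose powers have `B = D` (`(E × S)^{N+1} ≼
E^{N+1} × S^{N+1}`, `isDivisorGenerated_powSucc_prod_of_isDivisorGenerated_prod_powSucc`): Moonen–Zarhin Thm. (3.2)(1)
as condition (D) for this class, the binder shape of the tree's named fact `Hazama1989_stablyNondegenerate_prod`
discharged here. [cite: MoonenZarhin1999LowDim, §3 Thm. (3.2)(1)] [cite: Hazama1989, Thm. (= Gordon 7.6.2)]
[cite: Gordon1999HodgeAVSurvey, Thm. 7.5 (1), Def. 7.6 and Thm. 7.6.2] -/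
theorem isStablyNondegenerate_curve_prod_of_isSimple_endRankFour (hA1 : Module.finrank ℚ A.endAlgebra = 1)
    (hA : A.dim = 1) (hS : C.IsSimple) (hCend : Module.finrank ℚ C.endAlgebra = 4) (hCdim : C.dim = 2)
    (hCD : IsStablyNondegenerate C) : IsStablyNondegenerate (A.prod C) := fun N =>
  isDivisorGenerated_powSucc_prod_of_isDivisorGenerated_prod_powSucc A C N
    (isDivisorGenerated_prod_of_avSlots_curve_quaternion hA1 hA hS hCend hCdim (AVSlots.powSucc A N)
      (AVSlots.powSucc C N) (hCD N))

end ProductSpan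

/-! ### §3 The rows `E × S`, `S` simple with `dim_ℚ End⁰(S) = 4` (Types II(1) and IV(2,1)); the real splitting of Type II(1) -/

section QuaternionSurface

variable {E S : AbelianVariety ℂ}

/-- **`E × S` is stably nondegenerate for `E` an elliptic curve with `End⁰(E) = ℚ` and `S` ANY simple abelian surface
with `dim_ℚ End⁰(S) = 4`** (Type II(1): `End⁰(S)` an indefinite quaternion algebra; Type IV(2,1): a quartic CM field) —
UNCONDITIONAL, no binder: `B(S^{N+1}) = D(S^{N+1})` for every simple abelian surface is the tree's
`AbelianVariety.isStablyNondegenerate_of_isSimple_surface` (Moonen–Zarhin (2.2)). [cite: MoonenZarhin1999LowDim, Thm. 0.1 (4), §2 (2.2) and §3 Thm. (3.2)]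
[cite: Hazama1989, Thm. (= Gordon 7.6.2)] -/
theorem isStablyNondegenerate_curve_prod_of_isSimple_surface_endRankFour (hE1 : Module.finrank ℚ E.endAlgebra = 1)
    (hE : E.dim = 1) (hS : S.IsSimple) (hS4 : Module.finrank ℚ S.endAlgebra = 4) (hS2 : S.dim = 2) :
    IsStablyNondegenerate (E.prod S) :=
  isStablyNondegenerate_curve_prod_of_isSimple_endRankFour hE1 hE hS hS4 hS2
    (AbelianVariety.isStablyNondegenerate_of_isSimple_surface S hS hS2)

/-- **`dim_ℚ End⁰(S) = 4` from a real splitting `ℝ ⊗_ℚ End⁰(S) ≅ M₂(ℝ)`** (`= 4 · |Fin 1|`,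
`RealSplitting.finrank_eq_four_mul_card`). [cite: BanaszakGajdaKrason2006, p. 36] [cite: MoonenZarhin1999LowDim, §2 (2.2)] -/
theorem finrank_endAlgebra_eq_four_of_surface_realSplitting
    (Φ₁ : ℝ ⊗[ℚ] S.endAlgebra ≃ₐ[ℝ] Matrix (Fin 2) (Fin 2) ℝ) : Module.finrank ℚ S.endAlgebra = 4 := by
  have h := RealSplitting.finrank_eq_four_mul_card
    (Φ₁.trans (AlgEquiv.funUnique ℝ (Fin 1) (Matrix (Fin 2) (Fin 2) ℝ)).symm)
  rw [Fintype.card_fin, mul_one] at h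
  exact h

/-- **THE ROW `E × S(II(1))` OF MOONEN–ZARHIN Thm. 0.1 (4), PROVED: `E × S` is stably nondegenerate** for an
elliptic curve `E` with `End⁰(E) = ℚ` and a SIMPLE abelian surface `S` with a real splitting
`ℝ ⊗ End⁰(S) ≅ M₂(ℝ)` (quaternionic multiplication: `End⁰(S)` an indefinite quaternion division algebra over `ℚ`,
Type 2(1)) — every power `(E × S)^{N+1}` has `B = D` and satisfies the Hodge conjecture. UNCONDITIONAL, no binder.
[cite: MoonenZarhin1999LowDim, Thm. 0.1 (4), §2 (2.2) and §3 Thm. (3.2)(1)] [cite: Hazama1989, Thm. (= Gordon 7.6.2)]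
[cite: BanaszakGajdaKrason2006, Thm. 7.34] -/
theorem isStablyNondegenerate_curve_prod_of_surface_realSplitting (hE1 : Module.finrank ℚ E.endAlgebra = 1)
    (hE : E.dim = 1) (hS : S.IsSimple) (Φ₁ : ℝ ⊗[ℚ] S.endAlgebra ≃ₐ[ℝ] Matrix (Fin 2) (Fin 2) ℝ) (hS2 : S.dim = 2) :
    IsStablyNondegenerate (E.prod S) :=
  isStablyNondegenerate_curve_prod_of_isSimple_surface_endRankFour hE1 hE hS
    (finrank_endAlgebra_eq_four_of_surface_realSplitting Φ₁) hS2

end QuaternionSurface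

/-! ### §4 `E × S` for a non-CM elliptic curve `E` and EVERY simple abelian surface `S` -/

section EverySimpleSurface

variable {E S : AbelianVariety ℂ}

/-- **An abelian variety with `End⁰ = ℚ` is simple** (`End⁰(E)` is then a field, so a domain: Mumford §19 Cor. 2,
the tree's `AbelianVariety.isSimple_of_forall_mul_eq_zero`). [cite: MumfordAV1970, §19 Cor. 2 of Thm. 1 (p. 174)] -/
theorem isSimple_of_finrank_endAlgebra_eq_one (hE1 : Module.finrank ℚ E.endAlgebra = 1) : E.IsSimple := by
  have hF : IsField E.endAlgebra := isField_endAlgebra_of_finrank_eq_one hE1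
  refine AbelianVariety.isSimple_of_forall_mul_eq_zero fun x y hxy => ?_
  by_cases hx : x = 0
  · exact Or.inl hx
  obtain ⟨b, hb⟩ := hF.mul_inv_cancel hx
  refine Or.inr ?_
  calc y = (x * b) * y := by rw [hb, one_mul]
    _ = b * (x * y) := by rw [hF.mul_comm x b, mul_assoc]
    _ = 0 := by rw [hxy, mul_zero]

/-- **MOONEN–ZARHIN Thm. 0.1 FOR THE THREEFOLDS `E × S`, `E` WITHOUT COMPLEX MULTIPLICATION, PROVED: `E × S` is stably
nondegenerate for every elliptic curve `E` with `End⁰(E) = ℚ` and EVERY simple complex abelian surface `S`** — every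
power `(E × S)^{N+1}` has `B = D`. By `dim_ℚ End⁰(S) ∈ {1, 2, 4}` (`AbelianVariety.finrank_endAlgebra_eq_of_isSimple_surface`):
Type I(1) is the tree's `isStablyNondegenerate_curve_prod_of_endRankOne` (programme R14, `Hg(S) = Sp₄`); Type I(2)
(`End⁰(S)` a REAL quadratic field, `AbelianVariety.isTotallyReal_endField_of_surface`) is `HasRealSl2Blocks.isStablyNondegenerate_prod`
(both factors carriers of real `𝔰𝔩₂`-blocks, `Hom(E, S) = 0` both ways since `E`, `S` are simple of different
dimension); `dim_ℚ End⁰(S) = 4` (Types II(1), IV(2,1)) is §3. UNCONDITIONAL, no binder, nothing assumed about HC_CM.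
[cite: MoonenZarhin1999LowDim, Thm. 0.1 (4), §2 (2.2) and §3 Thm. (3.2)] [cite: Hazama1989, Thm. (= Gordon 7.6.2)]
[cite: MumfordAV1970, §19 Cor. 2 of Thm. 1 (p. 174)] -/
theorem isStablyNondegenerate_curve_prod_of_isSimple_surface (hE1 : Module.finrank ℚ E.endAlgebra = 1)
    (hE : E.dim = 1) (hS : S.IsSimple) (hS2 : S.dim = 2) : IsStablyNondegenerate (E.prod S) := by
  rcases AbelianVariety.finrank_endAlgebra_eq_of_isSimple_surface hS hS2 with h1 | h2 | h4
  · exact isStablyNondegenerate_curve_prod_of_endRankOne hE1 hE h1 (Or.inl hS2)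
  · have h0 : 0 < S.dim := by omega
    have hF : IsField S.endAlgebra := AbelianVariety.isField_endAlgebra_of_isSimple_of_finrank_eq_two hS h0 h2
    haveI : NumberField.IsTotallyReal (EndField S hF) := AbelianVariety.isTotallyReal_endField_of_surface hS2 h2 hF
    have hni : ¬ AbelianVariety.IsIsogenous E S := fun h => by
      have hd := AbelianVariety.dim_eq_of_isIsogenous_holds h
      omega
    obtain ⟨hES, hSE⟩ := orthogonal_of_isSimple_of_not_isIsogenous₂ (isSimple_of_finrank_endAlgebra_eq_one hE1) hS hni
    exact (hasRealSl2Blocks_of_finrank_endAlgebra_eq_one E hE1 hE).isStablyNondegenerate_prod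
      (hasRealSl2Blocks_of_isTotallyReal S hF (by rw [h2, hS2])) hES hSE
  · exact isStablyNondegenerate_curve_prod_of_isSimple_surface_endRankFour hE1 hE hS h4 hS2

/-- **All `E^{M+1} × S^{N+1}` are stably nondegenerate** (`E` a non-CM elliptic curve, `S` any simple abelian surface).
[cite: MoonenZarhin1999LowDim, Thm. 0.1 (4) and §3 (3.1)–(3.2)] [cite: Gordon1999HodgeAVSurvey, Def. 7.6 and Thm. 7.6.2] -/
theorem isStablyNondegenerate_powSucc_curve_prod_powSucc_of_isSimple_surface (hE1 : Module.finrank ℚ E.endAlgebra = 1)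
    (hE : E.dim = 1) (hS : S.IsSimple) (hS2 : S.dim = 2) (M N : ℕ) :
    IsStablyNondegenerate ((E.powSucc M).prod (S.powSucc N)) :=
  (isStablyNondegenerate_curve_prod_of_isSimple_surface hE1 hE hS hS2).powSucc_prod_powSucc M N

/-- **`B(E^{M+1} × S^{N+1}) = D(E^{M+1} × S^{N+1})`** for a non-CM elliptic curve `E` and any simple abelian surface `S`.
[cite: MoonenZarhin1999LowDim, Thm. 0.1 (4) and §3 (3.1)–(3.2)] -/
theorem isDivisorGenerated_powSucc_curve_prod_powSucc_of_isSimple_surface (hE1 : Module.finrank ℚ E.endAlgebra = 1)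
    (hE : E.dim = 1) (hS : S.IsSimple) (hS2 : S.dim = 2) (M N : ℕ) :
    IsDivisorGenerated ((E.powSucc M).prod (S.powSucc N)) :=
  (isStablyNondegenerate_powSucc_curve_prod_powSucc_of_isSimple_surface hE1 hE hS hS2 M N).isDivisorGenerated

/-- **The Hodge conjecture for every `E^{M+1} × S^{N+1}`** (`E` a non-CM elliptic curve, `S` any simple abelian
surface) — UNCONDITIONAL (`B = D` and Lefschetz `(1,1)`). [cite: MoonenZarhin1999LowDim, Thm. 0.1 (4) and §2 condition (D)]
[cite: vanGeemen1994HodgeAV, §2.4] -/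
theorem hodgeConjectureFor_powSucc_curve_prod_powSucc_of_isSimple_surface (hE1 : Module.finrank ℚ E.endAlgebra = 1)
    (hE : E.dim = 1) (hS : S.IsSimple) (hS2 : S.dim = 2) (M N : ℕ) :
    HodgeConjectureFor ((E.powSucc M).prod (S.powSucc N)).dim ((E.powSucc M).prod (S.powSucc N)).X :=
  (isStablyNondegenerate_powSucc_curve_prod_powSucc_of_isSimple_surface hE1 hE hS hS2 M N).hodgeConjectureFor

/-- **The Hodge conjecture for `E × S` itself.** [cite: MoonenZarhin1999LowDim, Thm. 0.1 (4)] -/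
theorem hodgeConjectureFor_curve_prod_of_isSimple_surface (hE1 : Module.finrank ℚ E.endAlgebra = 1) (hE : E.dim = 1)
    (hS : S.IsSimple) (hS2 : S.dim = 2) : HodgeConjectureFor (E.prod S).dim (E.prod S).X :=
  (isStablyNondegenerate_curve_prod_of_isSimple_surface hE1 hE hS hS2).hodgeConjectureFor

/-- **The Hodge conjecture for every abelian variety isogenous to a power `(E × S)^{N+1}`** (van Geemen's
Lemma 3.7; in particular `S × E` and all `E^a × S^b` up to isogeny). [cite: vanGeemen1994HodgeAV, Lemma 3.7]
[cite: MoonenZarhin1999LowDim, Thm. 0.1 (4)] -/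
theorem hodgeConjectureFor_of_isIsogenous_powSucc_curve_prod_of_isSimple_surface
    (hE1 : Module.finrank ℚ E.endAlgebra = 1) (hE : E.dim = 1) (hS : S.IsSimple) (hS2 : S.dim = 2)
    {X : AbelianVariety ℂ} {N : ℕ} (hX : AbelianVariety.IsIsogenous X ((E.prod S).powSucc N)) :
    HodgeConjectureFor X.dim X.X :=
  (isStablyNondegenerate_curve_prod_of_isSimple_surface hE1 hE hS hS2).hodgeConjectureFor_of_isIsogenous_powSucc hX

/-- **Isogeny invariance of the row**: every abelian variety isogenous to `E × S` is stably nondegenerate.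
[cite: vanGeemen1994HodgeAV, §3.6 (p. 236)] [cite: MoonenZarhin1999LowDim, Thm. 0.1 (4)] -/
theorem isStablyNondegenerate_of_isIsogenous_curve_prod_of_isSimple_surface
    (hE1 : Module.finrank ℚ E.endAlgebra = 1) (hE : E.dim = 1) (hS : S.IsSimple) (hS2 : S.dim = 2)
    {X : AbelianVariety ℂ} (hX : AbelianVariety.IsIsogenous X (E.prod S)) : IsStablyNondegenerate X :=
  (isStablyNondegenerate_curve_prod_of_isSimple_surface hE1 hE hS hS2).of_isIsogenous hX

end EverySimpleSurface

end Literature.AlgebraicGeometry.HodgeTheory
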